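/-
COR-CM (cell pub-hodgecm2, stage 2 of the Hodge ladder) — lane V-TRANSPORT (seat b06 gen 22; count-neutral, no
BINDER-OWNERS row): the hermitian space `V : HermSpace3 L ι₁` of a Picard modular surface is a REMOVABLE binder — any two are
similar (Landherr, odd rank 3) and their levels correspond under conjugation by the similitude.  CREDIT: the row
`TowerDominance` and the «one tower per field» economy are b01-idea-1 gen 7's (HOME/b01/IDEA-1g-one-tower-per-field.md,
route L1g-A); this file supplies steps A1 (similitude) and A2 (level transport, exact — no principal levels) of that route.
-/
import Summits.HodgeConjecture.CorCM.CM.Basic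
import Literature.NumberTheory.QuadraticForms.LandherrHermitianSimilitude
import Literature.NumberTheory.Automorphic.UnitaryGroupLevelTransport
import HarnessLib

/-!
# COR-CM — any two hermitian 3-spaces of PerL's signature are similar; transport of levels

For a CM field `L`, an embedding `ι₁ : L →+* ℂ` and two hermitian 3-spaces `V V' : HermSpace3 L ι₁` (signature `(2,1)`
at the place of `ι₁`, `(3,0)` elsewhere; `CorCM/CM/Basic.lean`):

* `HermSpace3.transpose_map_complexConj`, `HermSpace3.det_ne_zero`, `HermSpace3.card_pos_eigenvalues_of_mk_eq/_of_mk_ne` — the Gram matrix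
  is hermitian and non-degenerate, and at a complex embedding `τ` the complex hermitian matrix `τ(Hm)` has exactly `2`
  positive eigenvalues if `τ` defines the place of `ι₁` and `3` otherwise (Sylvester's law of inertia, tree
  `Landherr.card_pos_le_of_congr`, applied to the `signature_ι₁` / `posDef_of_ne` fields);
* **`HermSpace3.similar`** — `ᵗ(c̄B) · (a • V.Hm) · B = V'.Hm` for some `B ∈ GL₃(L)` and some TOTALLY POSITIVE
  `a ∈ L⁺` (`c̄ a = a`, `0 < τ a` at every `τ`): Landherr's theorem in odd rank (tree
  `hermitianMatrices_similar_of_posIndex_eq`, [Landherr1936HermitianForms]; Rogawski 1990 §1.9);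
* **`Level.transport`** — the level `(B⁻¹ Γ B, B_f⁻¹ K B_f)` of `V'` obtained from a level `(Γ, K)` of `V` by the adelic
  conjugation isomorphism `UnitaryGroup.finAdelicCongr` (tree `UnitaryGroupLevelTransport`): compact open, arithmetic
  level `B⁻¹ Γ B` EXACTLY (`Level.transport_Γ`, `Level.mem_transport_Γ_iff`, `Level.map_conj_transport_Γ`), torsion-free.

Consumer: `CorCM/TowerTransport.lean` (the surfaces `P(V', Γ.transport)` and `P(V, Γ)` of the universe of record are
isomorphic by `[v] ↦ [√ι₁(a) · B^{ι₁} v]`; `PeriodNV` is `V`-independent; `PerL → PerL44`; `∃V`-form `→ PeriodThmF`).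
One structure-valued `def` (`Level.transport`), theorems otherwise; nothing cited as a record, nothing asserted.
-/

noncomputable section

open scoped Matrix ComplexOrder
open NumberField
open Literature.NumberTheory.Automorphic
open Literature.NumberTheory.QuadraticForms
open Literature.AlgebraicGeometry.ShimuraVarieties

namespace Summit.HodgeConjecture.CorCM

/-! ### Sylvester: the positive index of a complex hermitian matrix congruent to `diag(1,1,-1)` -/

/-- The signature matrix `diag(1,1,-1)` has exactly two positive diagonal entries. [folklore] -/
theorem card_pos_signature_two :
    (Finset.univ.filter fun i : Fin 3 ↦ 0 < ((fun i : Fin 3 ↦ if i = Fin.last 2 then (-1 : ℂ) else 1) i).re).card = 2 := by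
  have h : (Finset.univ.filter fun i : Fin 3 ↦ 0 < ((fun i : Fin 3 ↦ if i = Fin.last 2 then (-1 : ℂ) else 1) i).re) =
      Finset.univ.filter fun i : Fin 3 ↦ i ≠ Fin.last 2 := by
    apply Finset.filter_congr
    intro i _
    fin_cases i <;> simp [Fin.last]
  rw [h]
  decide

/-- `signatureMatrix 2 = diag(1,1,-1)` as a `Matrix.diagonal`. [folklore] -/
theorem signatureMatrix_two_eq_diagonal :
    signatureMatrix 2 = Matrix.diagonal fun i : Fin 3 ↦ if i = Fin.last 2 then (-1 : ℂ) else 1 := rfl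

/-- `det diag(1,1,-1) = -1`. [folklore] -/
theorem det_signatureMatrix_two : (signatureMatrix 2).det = -1 := by
  rw [signatureMatrix_two_eq_diagonal, Matrix.det_diagonal, Fin.prod_univ_three]
  simp [Fin.last, Fin.ext_iff]

/-- **Sylvester's law of inertia at signature `(2,1)`**: a complex hermitian `3 × 3` matrix congruent to `diag(1,1,-1)`
by an invertible matrix has exactly two positive eigenvalues. [folklore] -/
theorem card_pos_eigenvalues_of_congr_signatureMatrix {A : Matrix (Fin 3) (Fin 3) ℂ} (hA : A.IsHermitian)
    (T : GL (Fin 3) ℂ) (hT : (T : Matrix (Fin 3) (Fin 3) ℂ)ᴴ * A * (T : Matrix (Fin 3) (Fin 3) ℂ) = signatureMatrix 2) :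
    (Finset.univ.filter fun i ↦ 0 < hA.eigenvalues i).card = 2 := by
  set U : Matrix (Fin 3) (Fin 3) ℂ := (hA.eigenvectorUnitary : Matrix (Fin 3) (Fin 3) ℂ) with hUdef
  set D : Matrix (Fin 3) (Fin 3) ℂ := Matrix.diagonal (RCLike.ofReal ∘ hA.eigenvalues) with hDdef
  -- the spectral theorem: `Uᴴ A U = D`, `U Uᴴ = 1`
  have hU : Uᴴ * A * U = D := by
    have h := hA.conjStarAlgAut_star_eigenvectorUnitary
    rw [Unitary.conjStarAlgAut_star_apply, Matrix.star_eq_conjTranspose] at h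
    exact h
  have hUU : U * Uᴴ = 1 := by
    have h := Unitary.coe_mul_star_self hA.eigenvectorUnitary
    rwa [Unitary.coe_star, Matrix.star_eq_conjTranspose] at h
  have hAeq : U * D * Uᴴ = A := by
    rw [← hU]
    calc U * (Uᴴ * A * U) * Uᴴ = (U * Uᴴ) * A * (U * Uᴴ) := by simp only [Matrix.mul_assoc]
      _ = A := by rw [hUU, Matrix.one_mul, Matrix.mul_one]
  have hT1 : (T : Matrix (Fin 3) (Fin 3) ℂ) * ((T⁻¹ : GL (Fin 3) ℂ) : Matrix (Fin 3) (Fin 3) ℂ) = 1 := Units.mul_inv T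
  have hTc : ((T⁻¹ : GL (Fin 3) ℂ) : Matrix (Fin 3) (Fin 3) ℂ)ᴴ * (T : Matrix (Fin 3) (Fin 3) ℂ)ᴴ = 1 := by
    rw [← Matrix.conjTranspose_mul, hT1, Matrix.conjTranspose_one]
  rw [signatureMatrix_two_eq_diagonal] at hT
  apply le_antisymm
  · -- `#pos eigenvalues ≤ 2`: `(T⁻¹ U)ᴴ · diag(1,1,-1) · (T⁻¹ U) = D`
    have h2 : (((T⁻¹ : GL (Fin 3) ℂ) : Matrix (Fin 3) (Fin 3) ℂ) * U)ᴴ *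
        (Matrix.diagonal fun i : Fin 3 ↦ if i = Fin.last 2 then (-1 : ℂ) else 1) *
        (((T⁻¹ : GL (Fin 3) ℂ) : Matrix (Fin 3) (Fin 3) ℂ) * U) = D := by
      rw [← hT, Matrix.conjTranspose_mul]
      calc Uᴴ * ((T⁻¹ : GL (Fin 3) ℂ) : Matrix (Fin 3) (Fin 3) ℂ)ᴴ *
            ((T : Matrix (Fin 3) (Fin 3) ℂ)ᴴ * A * (T : Matrix (Fin 3) (Fin 3) ℂ)) *
            (((T⁻¹ : GL (Fin 3) ℂ) : Matrix (Fin 3) (Fin 3) ℂ) * U)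
          = Uᴴ * (((T⁻¹ : GL (Fin 3) ℂ) : Matrix (Fin 3) (Fin 3) ℂ)ᴴ * (T : Matrix (Fin 3) (Fin 3) ℂ)ᴴ) * A *
              ((T : Matrix (Fin 3) (Fin 3) ℂ) * ((T⁻¹ : GL (Fin 3) ℂ) : Matrix (Fin 3) (Fin 3) ℂ)) * U := by
            simp only [Matrix.mul_assoc]
        _ = D := by rw [hTc, hT1, Matrix.mul_one, Matrix.mul_one, hU]
    have h := Landherr.card_pos_le_of_congr h2
    rwa [Landherr.card_pos_re_ofReal, card_pos_signature_two] at h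
  · -- `2 ≤ #pos eigenvalues`: `(Uᴴ T)ᴴ · D · (Uᴴ T) = diag(1,1,-1)`
    have h1 : (Uᴴ * (T : Matrix (Fin 3) (Fin 3) ℂ))ᴴ * D * (Uᴴ * (T : Matrix (Fin 3) (Fin 3) ℂ)) =
        Matrix.diagonal fun i : Fin 3 ↦ if i = Fin.last 2 then (-1 : ℂ) else 1 := by
      rw [Matrix.conjTranspose_mul, Matrix.conjTranspose_conjTranspose, ← hT, ← hAeq]
      simp only [Matrix.mul_assoc]
    have h := Landherr.card_pos_le_of_congr h1
    rwa [Landherr.card_pos_re_ofReal, card_pos_signature_two] at h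

namespace HermSpace3

variable {L : CMField} {ι₁ : L →+* ℂ}

/-- The Gram matrix of a hermitian 3-space is hermitian in Landherr's currency: `ᵗ(c̄ Hm) = Hm`. [folklore] -/
theorem transpose_map_complexConj (V : HermSpace3 L ι₁) : V.Hm.transpose.map (IsCMField.complexConj L) = V.Hm := by
  ext i j
  exact V.isHermitian j i

/-- **The Gram matrix of a hermitian 3-space is non-degenerate** (`det Hm ≠ 0`): at `ι₁` it is congruent to `diag(1,1,-1)`.
[folklore] -/
theorem det_ne_zero (V : HermSpace3 L ι₁) : V.Hm.det ≠ 0 := by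
  obtain ⟨T, hT⟩ := V.signature_ι₁
  intro h0
  have h1 : (V.Hm.map ι₁).det = 0 := by
    rw [← RingHom.mapMatrix_apply, ← RingHom.map_det, h0, map_zero]
  have h2 := congrArg Matrix.det hT
  rw [Matrix.det_mul, Matrix.det_mul, h1, mul_zero, zero_mul, det_signatureMatrix_two] at h2
  norm_num at h2

/-- The complex hermitian matrix `τ(Hm)` at an embedding `τ`. [folklore] -/
theorem isHermitian_map (V : HermSpace3 L ι₁) (τ : L →+* ℂ) : (V.Hm.map τ).IsHermitian :=
  Landherr.isHermitian_map L V.transpose_map_complexConj τ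

/-- **The positive index of `τ(Hm)` at the place of `ι₁` is `2`** (signature `(2,1)`; both `τ = ι₁` and `τ = conj ∘ ι₁`,
the latter by conjugating the Sylvester datum entrywise). [folklore] -/
theorem card_pos_eigenvalues_of_mk_eq (V : HermSpace3 L ι₁) {τ : L →+* ℂ}
    (hτ : InfinitePlace.mk τ = InfinitePlace.mk ι₁) :
    (Finset.univ.filter fun i ↦ 0 < (V.isHermitian_map τ).eigenvalues i).card = 2 := by
  obtain ⟨T, hT⟩ := V.signature_ι₁
  rcases InfinitePlace.mk_eq_iff.mp hτ with h | h
  · subst h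
    exact card_pos_eigenvalues_of_congr_signatureMatrix (V.isHermitian_map τ) T hT
  · -- `τ = conjugate ι₁`
    have hτ' : τ = NumberField.ComplexEmbedding.conjugate ι₁ := by
      rw [← h, NumberField.ComplexEmbedding.involutive_conjugate]
    have hmap : V.Hm.map τ = (V.Hm.map ι₁).map (starRingEnd ℂ) := by
      rw [hτ', Matrix.map_map]
      rfl
    set Tc : GL (Fin 3) ℂ := Matrix.GeneralLinearGroup.map (starRingEnd ℂ) T with hTc
    have hTc' : (Tc : Matrix (Fin 3) (Fin 3) ℂ) = (T : Matrix (Fin 3) (Fin 3) ℂ).map (starRingEnd ℂ) := rfl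
    have hsig : (signatureMatrix 2).map (starRingEnd ℂ) = signatureMatrix 2 := by
      rw [signatureMatrix_two_eq_diagonal, Matrix.diagonal_map (map_zero _)]
      congr 1
      funext i
      split_ifs <;> simp
    have hT' : (Tc : Matrix (Fin 3) (Fin 3) ℂ)ᴴ * V.Hm.map τ * (Tc : Matrix (Fin 3) (Fin 3) ℂ) = signatureMatrix 2 := by
      have hc := congrArg (fun M : Matrix (Fin 3) (Fin 3) ℂ ↦ M.map (starRingEnd ℂ)) hT
      simp only [Matrix.map_mul] at hc
      rw [hsig] at hc
      rw [hTc', hmap, ← Matrix.conjTranspose_map (starRingEnd ℂ) (fun _ ↦ rfl)]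
      exact hc
    exact card_pos_eigenvalues_of_congr_signatureMatrix (V.isHermitian_map τ) Tc hT'

/-- **The positive index of `τ(Hm)` off the place of `ι₁` is `3`** (positive definite). [folklore] -/
theorem card_pos_eigenvalues_of_mk_ne (V : HermSpace3 L ι₁) {τ : L →+* ℂ}
    (hτ : InfinitePlace.mk τ ≠ InfinitePlace.mk ι₁) :
    (Finset.univ.filter fun i ↦ 0 < (V.isHermitian_map τ).eigenvalues i).card = 3 := by
  have hpos := (V.posDef_of_ne τ hτ).eigenvalues_pos
  have : (Finset.univ.filter fun i ↦ 0 < (V.isHermitian_map τ).eigenvalues i) = Finset.univ :=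
    Finset.filter_true_of_mem fun i _ ↦ hpos i
  rw [this, Finset.card_univ, Fintype.card_fin]

/-- Any two hermitian 3-spaces over `(L, ι₁)` have the same positive index at every complex embedding. [folklore] -/
theorem card_pos_eigenvalues_eq (V V' : HermSpace3 L ι₁) (τ : L →+* ℂ) :
    (Finset.univ.filter fun i ↦ 0 < (V.isHermitian_map τ).eigenvalues i).card =
      (Finset.univ.filter fun i ↦ 0 < (V'.isHermitian_map τ).eigenvalues i).card := by
  by_cases hτ : InfinitePlace.mk τ = InfinitePlace.mk ι₁
  · rw [V.card_pos_eigenvalues_of_mk_eq hτ, V'.card_pos_eigenvalues_of_mk_eq hτ]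
  · rw [V.card_pos_eigenvalues_of_mk_ne hτ, V'.card_pos_eigenvalues_of_mk_ne hτ]

/-- **Landherr: any two hermitian 3-spaces of PerL's signature over `(L, ι₁)` are SIMILAR** — `ᵗ(c̄B) · (a • V.Hm) · B = V'.Hm`
for some `B ∈ GL₃(L)` and a totally positive `a ∈ L⁺` (`c̄ a = a`, `0 < Re τ(a)` for all `τ`).  Odd rank: rescaling by the
totally positive `a = det Hm' / det Hm` moves the discriminant class at will (tree `hermitianMatrices_similar_of_posIndex_eq`;
Rogawski 1990 §1.9: for odd `n` there is a unique isomorphism class of unitary groups with given signatures).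
[cite: Landherr1936HermitianForms] -/
theorem similar (V V' : HermSpace3 L ι₁) :
    ∃ a : L, cmConjRingHom L a = a ∧ (∀ τ : L →+* ℂ, 0 < (τ a).re) ∧
      ∃ B : GL (Fin 3) L, formCongr (cmConjRingHom L) B (a • V.Hm) = V'.Hm := by
  have hodd : Odd (Fintype.card (Fin 3)) := by rw [Fintype.card_fin]; exact ⟨1, rfl⟩
  obtain ⟨a, ha, hapos, B, hB⟩ := hermitianMatrices_similar_of_posIndex_eq L hodd V.Hm V'.Hm
    V.transpose_map_complexConj V'.transpose_map_complexConj V.det_ne_zero V'.det_ne_zero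
    (fun τ ↦ card_pos_eigenvalues_eq V V' τ)
  refine ⟨a, ha, hapos, B, ?_⟩
  rw [← hB, formCongr, Matrix.transpose_map]
  rfl

end HermSpace3

/-! ### Transport of levels along a rational similitude -/

namespace Level

variable {L : CMField} {ι₁ : L →+* ℂ} {V V' : HermSpace3 L ι₁}

/-- The similitude equation in the spelling of the vendored adelic unitary group (`IsCMField.complexConj L` coerced to a
ring map IS `cmConjRingHom L`, definitionally). [folklore] -/
theorem formCongr_complexConj_eq {B : GL (Fin 3) L} {a : L} (h : formCongr (cmConjRingHom L) B (a • V.Hm) = V'.Hm) :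
    formCongr ((IsCMField.complexConj L : L ≃ₐ[↥(maximalRealSubfield L)] L) : L →+* L) B (a • V.Hm) = V'.Hm := h

/-- **Transport of a level along a rational similitude** `ᵗ(c̄B) · (a • V.Hm) · B = V'.Hm`: the pair
`(B⁻¹ Γ B, B_f⁻¹ K B_f)` — the compact open is the preimage of `K` under the adelic conjugation isomorphism
`UnitaryGroup.finAdelicCongr : U(V')(𝔸_f) ≃ₜ* U(V)(𝔸_f)`, its arithmetic level is `B⁻¹ Γ B` on the nose
(`UnitaryGroup.arithmeticLevel_transport`), and `B⁻¹ Γ B` is torsion-free with `Γ`.  No principal congruence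
subgroups and no denominators enter. [cite: PlatonovRapinchuk1994, §4.1] -/
def transport (Γ : Level V) (B : GL (Fin 3) L) {a : L} (ha : a ≠ 0)
    (h : formCongr (cmConjRingHom L) B (a • V.Hm) = V'.Hm) : Level V' where
  Γ := Γ.Γ.comap (MulAut.conj B).toMonoidHom
  K := Γ.K.comap (UnitaryGroup.finAdelicCongr (↥(maximalRealSubfield L)) L (IsCMField.complexConj L) B ha
    (formCongr_complexConj_eq h)).toMonoidHom
  isCompact_K := UnitaryGroup.isCompact_comap_finAdelicCongr _ _ _ B ha (formCongr_complexConj_eq h) Γ.isCompact_K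
  isOpen_K := UnitaryGroup.isOpen_comap_finAdelicCongr _ _ _ B ha (formCongr_complexConj_eq h) Γ.isOpen_K
  arithmeticLevel_K := by
    rw [UnitaryGroup.arithmeticLevel_transport, Γ.arithmeticLevel_K]
  torsionFree γ hγ hfin := by
    have hγ' : B * γ * B⁻¹ ∈ Γ.Γ := hγ
    have h1 : B * γ * B⁻¹ = 1 := Γ.torsionFree _ hγ' ((MulAut.conj B).toMonoidHom.isOfFinOrder hfin)
    have h2 : (MulAut.conj B) γ = (MulAut.conj B) 1 := by rw [map_one]; exact h1
    exact (MulAut.conj B).injective h2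

variable (Γ : Level V) (B : GL (Fin 3) L) {a : L} (ha : a ≠ 0)
  (h : formCongr (cmConjRingHom L) B (a • V.Hm) = V'.Hm)

/-- The arithmetic group of the transported level is `B⁻¹ Γ B` (as the pull-back of `Γ` under conjugation by `B`). [folklore] -/
@[simp] theorem transport_Γ : (Γ.transport B ha h).Γ = Γ.Γ.comap (MulAut.conj B).toMonoidHom := rfl

/-- The compact open of the transported level is `B_f⁻¹ K B_f` (preimage under `finAdelicCongr`). [folklore] -/
theorem transport_K : (Γ.transport B ha h).K =
    Γ.K.comap (UnitaryGroup.finAdelicCongr (↥(maximalRealSubfield L)) L (IsCMField.complexConj L) B ha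
      (formCongr_complexConj_eq h)).toMonoidHom := rfl

/-- Membership: `γ ∈ B⁻¹ Γ B ↔ B γ B⁻¹ ∈ Γ`. [folklore] -/
theorem mem_transport_Γ_iff {γ : GL (Fin 3) L} : γ ∈ (Γ.transport B ha h).Γ ↔ B * γ * B⁻¹ ∈ Γ.Γ := Iff.rfl

/-- **`B · (B⁻¹ Γ B) · B⁻¹ = Γ`**: conjugation by `B` maps the transported group ONTO `Γ` — the hypothesis shape of the
ball-map transport (`UnitaryBallIsometricQuotients`, conjugate-EQUAL lattices). [folklore] -/
theorem map_conj_transport_Γ : (Γ.transport B ha h).Γ.map (MulAut.conj B).toMonoidHom = Γ.Γ :=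
  Subgroup.map_comap_eq_self_of_surjective (MulAut.conj B).surjective _

/-- In particular `B · (B⁻¹ Γ B) · B⁻¹ ≤ Γ` (the hypothesis shape of the Hecke translation). [folklore] -/
theorem map_conj_transport_Γ_le : (Γ.transport B ha h).Γ.map (MulAut.conj B).toMonoidHom ≤ Γ.Γ :=
  (map_conj_transport_Γ Γ B ha h).le

/-- Every element of `Γ` is `B γ B⁻¹` for a (unique) `γ = B⁻¹ δ B` of the transported group. [folklore] -/
theorem conj_inv_mem_transport_Γ {δ : GL (Fin 3) L} (hδ : δ ∈ Γ.Γ) : B⁻¹ * δ * B ∈ (Γ.transport B ha h).Γ := by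
  rw [mem_transport_Γ_iff]
  have hB : B * (B⁻¹ * δ * B) * B⁻¹ = δ := by group
  rw [hB]
  exact hδ

end Level

/-- **Levels exist on every hermitian 3-space as soon as they exist on one** (transport along Landherr's similitude).
[folklore] -/
theorem Level.nonempty_of_nonempty {L : CMField} {ι₁ : L →+* ℂ} {V : HermSpace3 L ι₁} (V' : HermSpace3 L ι₁)
    (hV : Nonempty (Level V)) : Nonempty (Level V') := by
  obtain ⟨Γ⟩ := hV
  obtain ⟨a, ha, hapos, B, hB⟩ := HermSpace3.similar V V'
  obtain ⟨τ⟩ : Nonempty (L →+* ℂ) := inferInstance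
  have ha0 : a ≠ 0 := fun h0 ↦ (lt_irrefl (0 : ℝ)) (by simpa [h0] using hapos τ)
  exact ⟨Γ.transport B ha0 hB⟩

end Summit.HodgeConjecture.CorCM

end
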